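import Summits.QuantumFields.BalabanUV.Beta.GAN24.DirichletVertexDomSumU
import Summits.QuantumFields.BalabanUV.Beta.GAN24.DirichletVertexFluxU
import Summits.QuantumFields.BalabanUV.Beta.GAN24.DirichletVertexEnd

/-!
# `BalabanUV.Beta.GAN24.DirichletVertexEndU` — binder row G-an2-4 / (CONV-C), road P2 PART IV, leaf L14 (the torus transfer), THE END,
# VOLUME-UNIFORM: THE TWO-LEVEL INJECTED LAW ON EVERY UNION OF UNIT BLOCKS IN `d = 2` WITH THE FULL RATE `C(a′, ε, R)/N` — the constant no
# longer depends on the number of blocks or of re-entrant vertices (unit b2b-balaban-gan24-p2, gen 27, v1)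

HONEST FRAMING (cell contract, verbatim): «discharging `BetaPertH` makes Bałaban's UV stability UNCONDITIONAL — a real constructive-QFT
result; it is NOT the continuum limit and NOT the Clay problem.»  SUPPLIER module under the T⁴-DAG sub-row `T4-U1a.S-NE2-D1-DIRICHLET°`
(holder: the t4-ne2-p1 lineage; owner wording R24 «the full rate L⁻¹ beyond boxes OPEN»).  The weighted socket
`DirichletBoxWeightedSockets.injected_le_of_weighted` (p234489, gen 24) gives `‖(D′^{Ω′})⁻¹J^Ω − J^Ω(D^Ω)⁻¹‖ ≤ (2/N)(√α′√β + √φ′√φ)` from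
four displayed one-level binders (A′), (B), (Φ′), (Φ).  `DirichletVertexEnd.injected_rate_union` (p247276) discharged them with a
constant carrying `|V|` and `|Tor M|` (LOCATED L27-1 of memo `gen27/L14-END.md`).  THIS FILE repeats the assembly with the VOLUME-FREE
suppliers: (B) `DirichletVertexLocalSums.weighted_energy_le_unif` (`|V| ↦ 4`, star-box identity p247556), (A′)/(A_ω)
`DirichletVertexDomSumU.dom_sum_solExt_unif` (`α_domU = 4C_gα₁ + 80g_max c_U`), (Φ)/(Φ′) `DirichletVertexFluxU` (`ρ₂ = (5/n)ω_V`, at most four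
vertex windows per site, p247653).  RESULT: `‖(D′^{Ω′})⁻¹J^Ω − J^Ω(D^Ω)⁻¹‖ ≤ CendU(R, ε, a′)/N` for EVERY set `S` of unit blocks of EVERY
coarse torus `Tor (fine N M)` (`M_ν ≥ 2`, `N ≥ 64`) — uniform in the volume, as needed along Bałaban's tower where the number of blocks
`M = L^{K−k}` varies with the step (`injected_le_union_unif`, `injected_rate_union_unif`).

## Contents ([folklore] assembly; 0 sorry)
* §1 `betaU`, `weighted_energy_solExt_unif` ((B) generic spelling, volume-free); the binders `binderAU`, `binderBU`, `hessian_omega_le_unif`,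
  `XfluxU`, `binderEU`, `binderTU`; §2 **`injected_le_union_unif`**, **`injected_rate_union_unif`**.

ABSOLUTE RULE (cell, verbatim): «No internally-minted statement may enter as a cited fact. Every hypothesis is either kernel-proved in
this package or a verbatim quotation of a PUBLISHED theorem with page reference. The manuscript(s) under audit are NOT citable for
their own disputed steps — they are the thing under adjudication; programme-internal (2001/route/tribunal) claims are never citable.»
Nothing printed is a hypothesis; all inputs are kernel theorems of this package on the tree's typed `U = 1` objects
([Balaban1985BackgroundPropagators] (3.24) p. 394 at `U = 1` is the DEFINITION of `Δ′`, not a hypothesis).  HONEST: `U = 1` SCALAR layer,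
`d = 2` only; constants `10⁹/(γ−1)`, `128⁴`, `80`, not optimised; `N ≥ 64`; NOT the vector layer `calDalev`, NOT `d = 3, 4`, NOT NE2, NOT (CONV-C) as a whole, NEVER «G-an2-4 closed»; NOT D1 ∕
BetaPertH ∕ continuum ∕ Clay.  «not in print; our proof attempt».  HONEST DEPENDENCY: continuum YM on T⁴ ⇐ BetaPertH ∧ nine spine
estimates (0/9 proved); BetaPertH ⇐ (D1) ∧ (D4) ∧ CAP+tail; G-an2-4 gates asym, D1 and NE2/3/4.
-/

noncomputable section

open scoped BigOperators ComplexConjugate Matrix Matrix.Norms.L2Operator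
open Finset

namespace Summit.QuantumFields.BalabanUV.Beta.GAN24.DirichletVertexEndU

open Literature.MathematicalPhysics.QuantumFieldTheory.Balaban1983to89.B5Prop11Plancherel (Tor fine unitVec)
open Literature.MathematicalPhysics.QuantumFieldTheory.Balaban1983to89.B5Action121 (sdiff LapS)
open Literature.MathematicalPhysics.QuantumFieldTheory.Balaban1983to89.B5Prop11Lower (nsq nsq_nonneg)
open Summit.QuantumFields.BalabanUV.T4Continuum.ScalarAveragedPropagator (gammaPs gammaPs_pos)
open Summit.QuantumFields.BalabanUV.Beta.GAN24.DirichletBoxRegularity (Pdir)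
open Summit.QuantumFields.BalabanUV.Beta.GAN24.DirichletBoxTrace (blockReg)
open Summit.QuantumFields.BalabanUV.Beta.GAN24.DirichletBoxCompression (DOm JOm solExt refineR solExt_apply_of_not)
open Summit.QuantumFields.BalabanUV.Beta.GAN24.DirichletBoxTwoLevelCore (bdryPart refineR_blockReg_iff)
open Summit.QuantumFields.BalabanUV.Beta.GAN24.DirichletBoxWeightedSockets (injected_le_of_weighted)
open DirichletRingCutoff (tIdx one_le_tIdx)
open DirichletRingHessianWindow (rho)
open DirichletVertexChart
open DirichletVertexEnergy (omegaV omegaV_pos omegaV_le_one betaV one_le_rho)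
open DirichletVertexHessian (alphaV)
open DirichletVertexRefine (wfine wfine_nonneg wfine_le_three wfine_emb_le wfine_hcomp omegaV_emb_le)
open Summit.QuantumFields.BalabanUV.Beta.GAN24.DirichletBoxCompression (dirichlet_solExt_le sum_normSq_LapS_solExt_le)
open Summit.QuantumFields.BalabanUV.T4Continuum.ScalarAveragedPropagator (dirichlet)
open DirichletVertexDomSum (cU)
open DirichletVertexDomSumU (alphaDomU dom_sum_solExt_unif)
open DirichletVertexFluxU (bdry_sum_le exterior_sum_le)
open DirichletVertexEnergyField (Vre Vre_sound Vre_complete exists_J)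
open DirichletVertexStarBox (reentrant_injOn)
open DirichletVertexLocalSums (weighted_energy_le_unif)
open DirichletVertexEnd (dyadic_window)

variable (N R : ℕ) [NeZero N] [NeZero R] (M : Fin 2 → ℕ) [hM : ∀ μ, NeZero (M μ)] (S : Tor M → Prop) [DecidablePred S] (a' : ℝ)

/-! ## §1 The four binders of the weighted socket on a union of unit blocks -/

section Binders

variable {ε : ℝ}

/-- the volume-free constant of binder (B): `β_U = γ′⁻¹(1 + 16(1+16/(γ−1))) + (512π/((γ−1)ε(2−γ)))·2(1+(a′γ′⁻¹)²)`. [folklore] -/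
def betaU (ε a' : ℝ) : ℝ :=
  (gammaPs 2 a')⁻¹ * (1 + 16 * (1 + 16 / (Real.pi / 3 * (1 - ε / 2) - 1)))
    + 512 * Real.pi / ((Real.pi / 3 * (1 - ε / 2) - 1) * ε * (2 - Real.pi / 3 * (1 - ε / 2))) * (2 * (1 + (a' * (gammaPs 2 a')⁻¹) ^ 2))

/-- **(B) FOR ANY DECIDABLE SPELLING OF THE BLOCK REGION, VOLUME-FREE** (level `n`, family of re-entrant vertices `V`). [folklore] -/
theorem weighted_energy_solExt_unif (n : ℕ) [NeZero n] (V : Finset ((Fin 2 → Bool) × Tor M)) (hV : ∀ v ∈ V, ReentrantAt M S v.1 v.2)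
    (hn : 2 ≤ n) (ha' : 0 < a') (hε : 0 < ε) (hγ : 1 < Real.pi / 3 * (1 - ε / 2))
    (p : Tor (fine n M) → Prop) [DecidablePred p] (hp : ∀ x, p x ↔ blockReg n M S x) (f : {y // p y} → ℂ) :
    ∑ μ, ∑ y, (omegaV n M V (n - 1) y)⁻¹ * ‖(sdiff (fine n M) (n : ℂ) μ *ᵥ solExt n M a' p f) y‖ ^ 2 ≤ betaU ε a' * nsq f := by
  set u := solExt n M a' p f with hu
  have hu0 : ∀ x, ¬ blockReg n M S x → u x = 0 := fun x hx => solExt_apply_of_not n M a' p f (fun h => hx ((hp x).mp h))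
  have hγp := (gammaPs_pos (d := 2) (a' := a')).1
  have hπ3 := Real.pi_gt_three
  have hε2 : ε < 2 := by
    by_contra h
    have : Real.pi / 3 * (1 - ε / 2) ≤ 0 := mul_nonpos_of_nonneg_of_nonpos (by positivity) (by linarith)
    linarith
  have hγ1 : 0 < Real.pi / 3 * (1 - ε / 2) - 1 := by linarith
  have h2γ : 0 < 2 - Real.pi / 3 * (1 - ε / 2) := by
    have h1 : Real.pi / 3 * (1 - ε / 2) ≤ Real.pi / 3 * 1 := mul_le_mul_of_nonneg_left (by linarith) (by positivity)
    linarith [Real.pi_lt_four]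
  have hE : nsq (sdiff (fine n M) (n : ℂ) 0 *ᵥ u) + nsq (sdiff (fine n M) (n : ℂ) 1 *ᵥ u) ≤ (gammaPs 2 a')⁻¹ * nsq f := by
    have h := dirichlet_solExt_le n M a' p ha' f
    rw [dirichlet, Fin.sum_univ_two] at h
    exact h
  have hB : ∑ x ∈ univ.filter (blockReg n M S), ‖(LapS (fine n M) (n : ℂ) *ᵥ u) x‖ ^ 2 ≤ 2 * (1 + (a' * (gammaPs 2 a')⁻¹) ^ 2) * nsq f := by
    rw [Finset.sum_subtype (univ.filter (blockReg n M S)) (p := p) (fun x => by simp [hp x])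
      (fun x => ‖(LapS (fine n M) (n : ℂ) *ᵥ u) x‖ ^ 2)]
    exact sum_normSq_LapS_solExt_le n M a' p ha' f
  have hf0 := nsq_nonneg f
  have hfield := weighted_energy_le_unif n M S V hV hu0 hn hε hγ
  refine hfield.trans ?_
  have hc1 : 0 ≤ 1 + 16 * (1 + 16 / (Real.pi / 3 * (1 - ε / 2) - 1)) := by positivity
  have hc2 : 0 ≤ 512 * Real.pi / ((Real.pi / 3 * (1 - ε / 2) - 1) * ε * (2 - Real.pi / 3 * (1 - ε / 2))) := by positivity
  calc _ ≤ (1 + 16 * (1 + 16 / (Real.pi / 3 * (1 - ε / 2) - 1))) * ((gammaPs 2 a')⁻¹ * nsq f)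
        + 512 * Real.pi / ((Real.pi / 3 * (1 - ε / 2) - 1) * ε * (2 - Real.pi / 3 * (1 - ε / 2)))
          * (2 * (1 + (a' * (gammaPs 2 a')⁻¹) ^ 2) * nsq f) :=
        add_le_add (mul_le_mul_of_nonneg_left hE hc1) (mul_le_mul_of_nonneg_left hB hc2)
    _ = betaU ε a' * nsq f := by rw [betaU]; ring

/-- **(A′): THE WEIGHTED INTERIOR HESSIAN OF THE FINE SOLUTION, VOLUME-FREE** with the socket's fine weight `w′ = wfine`:
`Σ_μ Σ_{x∈Ω′} w′(x)|(∂′ᴴ_μ∂′_μ v_w)(x)|² ≤ α_domU(3(1+2R), 3)·‖w‖²` (`N ≥ 64`). [folklore] -/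
theorem binderAU (hN : 64 ≤ N) (ha' : 0 < a') (hε : 0 < ε) (hγ : 1 < Real.pi / 3 * (1 - ε / 2))
    (w : {x // refineR N R M (blockReg N M S) x} → ℂ) :
    ∑ μ, ∑ x ∈ univ.filter (refineR N R M (blockReg N M S)),
        wfine N R M (Vre M S) (N - 1) x
          * ‖(Pdir (fine (R * N) M) ((R * N : ℕ) : ℂ) μ *ᵥ solExt (R * N) M a' (refineR N R M (blockReg N M S)) w) x‖ ^ 2
      ≤ alphaDomU (3 * (1 + 2 * R)) 3 ε a' * nsq w := by
  have hR1 : 1 ≤ R := Nat.pos_of_ne_zero (NeZero.ne R)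
  have hRN : 64 ≤ R * N := le_trans hN (Nat.le_mul_of_pos_left N hR1)
  obtain ⟨J, hJ1, hJ2⟩ := exists_J (R * N) hRN
  have hR0 : (0 : ℝ) < R := by exact_mod_cast hR1
  have hN0 : (0 : ℝ) < N := by exact_mod_cast Nat.pos_of_ne_zero (NeZero.ne N)
  refine dom_sum_solExt_unif (R * N) M S a' hRN (Vre M S) (Vre_sound M S) (Vre_complete M S) hJ2 hJ1 hε hγ ha'
    (g := wfine N R M (Vre M S) (N - 1)) (Cg := 3 * (1 + 2 * R)) (gmax := 3) (by positivity) (wfine_nonneg N R M _ _)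
    (wfine_le_three N R M _ _) (fun σ b hv i j _ hρ => ?_) (refineR N R M (blockReg N M S)) (refineR_blockReg_iff N R M S) w
  obtain ⟨hi, hj, -, -⟩ := dyadic_window N R hJ1 (by omega) hρ
  have h := wfine_emb_le N R M (V := Vre M S) hv (K := N - 1) (by omega) hi hj
  refine h.trans ?_
  have hρ1 : (1 : ℝ) ≤ (rho i j : ℝ) := by exact_mod_cast one_le_rho i j
  have e : ((R * N : ℕ) : ℝ) = (R : ℝ) * N := by push_cast; ring
  rw [e, div_le_div_iff_of_pos_right (by positivity)]
  nlinarith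

/-- **(B), VOLUME-FREE**: `Σ_μ Σ_y ω_V(y)⁻¹|(∂_μ u_f)(y)|² ≤ β_U·‖f‖²`. [folklore] -/
theorem binderBU (hN : 2 ≤ N) (ha' : 0 < a') (hε : 0 < ε) (hγ : 1 < Real.pi / 3 * (1 - ε / 2))
    (f : {y // blockReg N M S y} → ℂ) :
    ∑ μ, ∑ y, (omegaV N M (Vre M S) (N - 1) y)⁻¹ * ‖(sdiff (fine N M) (N : ℂ) μ *ᵥ solExt N M a' (blockReg N M S) f) y‖ ^ 2
      ≤ betaU ε a' * nsq f :=
  weighted_energy_solExt_unif M S a' N (Vre M S) (Vre_sound M S) hN ha' hε hγ (blockReg N M S) (fun _ => Iff.rfl) f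

/-- the volume-free flux constant `X_U = 18·β_U + 5·α_domU(1, 1)`. [folklore] -/
def XfluxU (ε a' : ℝ) : ℝ := 18 * betaU ε a' + 5 * alphaDomU 1 1 ε a'

/-- the dominated Hessian with `g = ω_V` at any level `n ≥ 64`, volume-free. [folklore] -/
theorem hessian_omega_le_unif (n : ℕ) [NeZero n] (hn : 64 ≤ n) (ha' : 0 < a') (hε : 0 < ε)
    (hγ : 1 < Real.pi / 3 * (1 - ε / 2)) (p : Tor (fine n M) → Prop) [DecidablePred p] (hp : ∀ x, p x ↔ blockReg n M S x)
    (f : {x // p x} → ℂ) :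
    ∑ μ, ∑ x ∈ univ.filter p, omegaV n M (Vre M S) (n - 1) x * ‖(Pdir (fine n M) (n : ℂ) μ *ᵥ solExt n M a' p f) x‖ ^ 2
      ≤ alphaDomU 1 1 ε a' * nsq f := by
  obtain ⟨J, hJ1, hJ2⟩ := exists_J n hn
  refine dom_sum_solExt_unif n M S a' hn (Vre M S) (Vre_sound M S) (Vre_complete M S) hJ2 hJ1 hε hγ ha'
    (g := omegaV n M (Vre M S) (n - 1)) (Cg := 1) (gmax := 1) zero_le_one (fun x => (omegaV_pos n M _ _ x).le)
    (omegaV_le_one n M _ _) (fun σ b hv i j _ hρ => ?_) p hp f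
  have hi : tIdx i ≤ rho i j := le_max_left _ _
  have hj : tIdx j ≤ rho i j := le_max_right _ _
  have h8 : (2 : ℤ) ^ (J + 3) = 8 * 2 ^ J := by ring
  have hP : ((2 ^ J : ℕ) : ℤ) = (2 : ℤ) ^ J := by push_cast; ring
  have hK : ((n - 1 : ℕ) : ℤ) = (n : ℤ) - 1 := by omega
  have h20 : (20 : ℤ) * 2 ^ J + 2 ≤ n := by rw [← hP]; omega
  have h := omegaV_emb_le n M (V := Vre M S) hv (K := n - 1) (i := i) (j := j) (by rw [hK]; nlinarith) (by rw [hK]; nlinarith)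
  rw [one_mul]
  exact h

/-- **(Φ′), VOLUME-FREE**: `Σ_μ Σ_{x∉Ω′}|(∂′ᴴ_μ∂′_μ v_w)(x)|² ≤ 4RN·X_U·‖w‖²`. [folklore] -/
theorem binderEU (hN : 64 ≤ N) (hM2 : ∀ ν, 2 ≤ M ν) (ha' : 0 < a') (hε : 0 < ε) (hγ : 1 < Real.pi / 3 * (1 - ε / 2))
    (w : {x // refineR N R M (blockReg N M S) x} → ℂ) :
    ∑ μ, ∑ x ∈ univ.filter (fun x => ¬ refineR N R M (blockReg N M S) x),
        ‖(Pdir (fine (R * N) M) ((R * N : ℕ) : ℂ) μ *ᵥ solExt (R * N) M a' (refineR N R M (blockReg N M S)) w) x‖ ^ 2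
      ≤ 4 * ((R * N : ℕ) : ℝ) * XfluxU ε a' * nsq w := by
  have hR1 : 1 ≤ R := Nat.pos_of_ne_zero (NeZero.ne R)
  have hRN : 64 ≤ R * N := le_trans hN (Nat.le_mul_of_pos_left N hR1)
  set v := solExt (R * N) M a' (refineR N R M (blockReg N M S)) w with hv
  have hiff := refineR_blockReg_iff N R M S
  have hv0 : ∀ x, ¬ blockReg (R * N) M S x → v x = 0 := fun x hx => solExt_apply_of_not (R * N) M a' _ w (fun h => hx ((hiff x).mp h))
  have hfilt : univ.filter (fun x => ¬ refineR N R M (blockReg N M S) x) = univ.filter (fun x => ¬ blockReg (R * N) M S x) :=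
    filter_congr fun x _ => not_congr (hiff x)
  have hfilt' : univ.filter (blockReg (R * N) M S) = univ.filter (refineR N R M (blockReg N M S)) := filter_congr fun x _ => (hiff x).symm
  rw [hfilt]
  have h0 := exterior_sum_le M (Vre M S) S N R (reentrant_injOn M (Vre M S) (Vre_sound M S)) (by omega) hM2 hv0
  have hB := weighted_energy_solExt_unif M S a' (R * N) (Vre M S) (Vre_sound M S) (by omega) ha' hε hγ
    (refineR N R M (blockReg N M S)) hiff w
  have hA := hessian_omega_le_unif M S a' (R * N) hRN ha' hε hγ (refineR N R M (blockReg N M S)) hiff w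
  rw [← hfilt'] at hA
  rw [← hv] at hB hA
  have hc : (0 : ℝ) ≤ 4 * ((R * N : ℕ) : ℝ) := by positivity
  refine h0.trans ?_
  rw [XfluxU]
  nlinarith [mul_le_mul_of_nonneg_left hB (by norm_num : (0 : ℝ) ≤ 18), mul_le_mul_of_nonneg_left hA (by norm_num : (0:ℝ) ≤ 5)]

/-- **(Φ), VOLUME-FREE**: `Σ_μ nsq(bdryPart(∂_μ u_f)) ≤ (2X_U/N)·‖f‖²`. [folklore] -/
theorem binderTU (hN : 64 ≤ N) (hM2 : ∀ ν, 2 ≤ M ν) (ha' : 0 < a') (hε : 0 < ε) (hγ : 1 < Real.pi / 3 * (1 - ε / 2))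
    (f : {y // blockReg N M S y} → ℂ) :
    ∑ μ, nsq (bdryPart N M (blockReg N M S) μ (sdiff (fine N M) (N : ℂ) μ *ᵥ solExt N M a' (blockReg N M S) f))
      ≤ 2 * XfluxU ε a' / N * nsq f := by
  have hN0 : (0 : ℝ) < N := by exact_mod_cast Nat.pos_of_ne_zero (NeZero.ne N)
  set u := solExt N M a' (blockReg N M S) f with hu
  have hu0 : ∀ y, ¬ blockReg N M S y → u y = 0 := fun y hy => solExt_apply_of_not N M a' _ f hy
  have h0 := bdry_sum_le N M (Vre M S) S (reentrant_injOn M (Vre M S) (Vre_sound M S)) (by omega) hM2 hu0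
  have hB := binderBU N M S a' (by omega) ha' hε hγ f
  have hA := hessian_omega_le_unif M S a' N hN ha' hε hγ (blockReg N M S) (fun _ => Iff.rfl) f
  rw [← hu] at hB hA
  refine h0.trans ?_
  have e : 2 * XfluxU ε a' / N * nsq f
      = 36 / (N : ℝ) * (betaU ε a' * nsq f) + 10 / (N : ℝ) * (alphaDomU 1 1 ε a' * nsq f) := by
    rw [XfluxU]; field_simp; ring
  rw [e]
  exact add_le_add (mul_le_mul_of_nonneg_left hB (by positivity)) (mul_le_mul_of_nonneg_left hA (by positivity))

end Binders

/-! ## §2 THE END: the two-level injected law on every union of unit blocks in two dimensions -/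

/-- nonnegativity of `β_U`. [folklore] -/
theorem betaU_nonneg {ε : ℝ} (hε : 0 < ε) (hγ : 1 < Real.pi / 3 * (1 - ε / 2)) : 0 ≤ betaU ε a' := by
  have hγp := (gammaPs_pos (d := 2) (a' := a')).1
  have hπ3 := Real.pi_gt_three
  set γ := Real.pi / 3 * (1 - ε / 2) with hγdef
  have hε2 : ε < 2 := by
    by_contra h
    have : Real.pi / 3 * (1 - ε / 2) ≤ 0 := mul_nonpos_of_nonneg_of_nonpos (by positivity) (by linarith)
    linarith
  have hγ1 : 0 < γ - 1 := by linarith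
  have h2γ : 0 < 2 - γ := by
    have h1 : Real.pi / 3 * (1 - ε / 2) ≤ Real.pi / 3 * 1 := mul_le_mul_of_nonneg_left (by linarith) (by positivity)
    linarith [Real.pi_lt_four]
  unfold betaU; positivity

/-- nonnegativity of `α_domU` (`0 ≤ C_g`, `0 ≤ g_max`). [folklore] -/
theorem alphaDomU_nonneg {Cg gmax ε : ℝ} (hCg : 0 ≤ Cg) (hg : 0 ≤ gmax) (hε : 0 < ε)
    (hγ : 1 < Real.pi / 3 * (1 - ε / 2)) : 0 ≤ alphaDomU Cg gmax ε a' := by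
  have hγp := (gammaPs_pos (d := 2) (a' := a')).1
  have hπ3 := Real.pi_gt_three
  set γ := Real.pi / 3 * (1 - ε / 2) with hγdef
  have hε2 : ε < 2 := by
    by_contra h
    have : Real.pi / 3 * (1 - ε / 2) ≤ 0 := mul_nonpos_of_nonneg_of_nonpos (by positivity) (by linarith)
    linarith
  have hγ1 : 0 < γ - 1 := by linarith
  have h2γ : 0 < 2 - γ := by
    have h1 : Real.pi / 3 * (1 - ε / 2) ≤ Real.pi / 3 * 1 := mul_le_mul_of_nonneg_left (by linarith) (by positivity)
    linarith [Real.pi_lt_four]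
  unfold alphaDomU alphaV DirichletVertexDomSum.cU; positivity

/-- **THE VOLUME-FREE END CONSTANT** `C_U(R, ε, a′) = 2·(√(α_domU(3(1+2R),3)·β_U) + √(8R)·X_U)`. [folklore] -/
def CendU (R : ℕ) (ε a' : ℝ) : ℝ :=
  2 * (Real.sqrt (alphaDomU (3 * (1 + 2 * R)) 3 ε a' * betaU ε a') + Real.sqrt (8 * R) * XfluxU ε a')

/-- **THE TWO-LEVEL INJECTED LAW ON EVERY UNION OF UNIT BLOCKS, `d = 2`, VOLUME-FREE** (socket form). [folklore] -/
theorem injected_le_union_unif (hN : 64 ≤ N) (hM2 : ∀ ν, 2 ≤ M ν) {a' : ℝ} (ha' : 0 < a') {ε : ℝ} (hε : 0 < ε)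
    (hγ : 1 < Real.pi / 3 * (1 - ε / 2)) :
    ‖(DOm (R * N) M a' (refineR N R M (blockReg N M S)))⁻¹ * JOm N R M (blockReg N M S)
        - JOm N R M (blockReg N M S) * (DOm N M a' (blockReg N M S))⁻¹‖
      ≤ 2 / (N : ℝ) * (Real.sqrt (alphaDomU (3 * (1 + 2 * R)) 3 ε a') * Real.sqrt (betaU ε a')
        + Real.sqrt (4 * ((R * N : ℕ) : ℝ) * XfluxU ε a') * Real.sqrt (2 * XfluxU ε a' / N)) := by
  have hN0 : (0 : ℝ) < N := by exact_mod_cast Nat.pos_of_ne_zero (NeZero.ne N)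
  have hβ := betaU_nonneg a' hε hγ
  have hαw := alphaDomU_nonneg a' (Cg := 3 * (1 + 2 * R)) (gmax := 3) (by positivity) (by norm_num) hε hγ
  have hα1 := alphaDomU_nonneg a' (Cg := 1) (gmax := 1) zero_le_one zero_le_one hε hγ
  have hX : 0 ≤ XfluxU ε a' := by unfold XfluxU; positivity
  exact injected_le_of_weighted N R M (blockReg N M S) a' (by omega) ha' (ω := omegaV N M (Vre M S) (N - 1))
    (w' := wfine N R M (Vre M S) (N - 1)) (omegaV_pos N M _ _) (wfine_nonneg N R M _ _) (wfine_hcomp N R M (Vre M S) (N - 1))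
    hαw hβ (by positivity) (by positivity)
    (binderAU N R M S a' hN ha' hε hγ) (binderBU N M S a' (by omega) ha' hε hγ)
    (binderEU N R M S a' hN hM2 ha' hε hγ) (binderTU N M S a' hN hM2 ha' hε hγ)

/-- **THE FULL RATE `1/N` ON EVERY UNION OF UNIT BLOCKS IN TWO DIMENSIONS, UNIFORMLY IN THE VOLUME**:
`‖(D′^{Ω′})⁻¹·J^Ω − J^Ω·(D^Ω)⁻¹‖ ≤ C_U(R, ε, a′) / N` for every set `S` of unit blocks of every coarse torus (`M_ν ≥ 2`, `N ≥ 64`). [folklore] -/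
theorem injected_rate_union_unif (hN : 64 ≤ N) (hM2 : ∀ ν, 2 ≤ M ν) {a' : ℝ} (ha' : 0 < a') {ε : ℝ} (hε : 0 < ε)
    (hγ : 1 < Real.pi / 3 * (1 - ε / 2)) :
    ‖(DOm (R * N) M a' (refineR N R M (blockReg N M S)))⁻¹ * JOm N R M (blockReg N M S)
        - JOm N R M (blockReg N M S) * (DOm N M a' (blockReg N M S))⁻¹‖
      ≤ CendU R ε a' / N := by
  have hN0 : (0 : ℝ) < N := by exact_mod_cast Nat.pos_of_ne_zero (NeZero.ne N)
  have hR0 : (0 : ℝ) ≤ R := Nat.cast_nonneg _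
  have hβ := betaU_nonneg a' hε hγ
  have hαw := alphaDomU_nonneg a' (Cg := 3 * (1 + 2 * R)) (gmax := 3) (by positivity) (by norm_num) hε hγ
  have hα1 := alphaDomU_nonneg a' (Cg := 1) (gmax := 1) zero_le_one zero_le_one hε hγ
  have hX : 0 ≤ XfluxU ε a' := by unfold XfluxU; positivity
  refine (injected_le_union_unif N R M S hN hM2 ha' hε hγ).trans (le_of_eq ?_)
  set X := XfluxU ε a' with hXdef
  have e1 : Real.sqrt (4 * ((R * N : ℕ) : ℝ) * X) * Real.sqrt (2 * X / N) = Real.sqrt (8 * R) * X := by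
    rw [← Real.sqrt_mul (by positivity)]
    have e : 4 * ((R * N : ℕ) : ℝ) * X * (2 * X / N) = (8 * R) * (X * X) := by push_cast; field_simp; ring
    rw [e, Real.sqrt_mul (by positivity), Real.sqrt_mul_self hX]
  have e2 : Real.sqrt (alphaDomU (3 * (1 + 2 * R)) 3 ε a') * Real.sqrt (betaU ε a')
      = Real.sqrt (alphaDomU (3 * (1 + 2 * R)) 3 ε a' * betaU ε a') := (Real.sqrt_mul hαw _).symm
  rw [e1, e2, CendU, hXdef]
  field_simp

end Summit.QuantumFields.BalabanUV.Beta.GAN24.DirichletVertexEndU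

end
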